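import Summits.KontsevichZagierPeriods.KontsevichZagierPeriods.Theses.UnfoldedStokes
import Literature.NumberTheory.Transcendental.KZSemiCanonicalReductionProofs

/-!
# Line `solid_step` — skeleton for piece `CubeKernelStep` (stmt-KontsevichZagierPeriods-17854)

Crux-strategist r1 (planner-cstrat-stmt-KontsevichZagierPeriods-3586-r1-0), 2026-08-17. Parent: the BC2
split of the RESTATED deciding crux `StokesGeneration` (stmt-3586) of route UnfoldedStokes into
{`ContinuousCubification` (17853), `PlanarAreas` (4990, shared), `CubeKernelStep` (17854)} with the
proved glue `StokesGenerationOfPieces` (17862).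

PIECE (conditional by design): for `d ≥ 1`, IF every closed-cube representation of dimension `≤ d`
with integrand continuous on the closed cube and value `0` is a relation THEN so is every such
representation of dimension `d + 1`. Primary plan: the LIVE LINE `fibrewise_stokes` of the parent
(its residual S2 implies the piece outright; its rungs are unconditional instances of the layers).
This file is the piece's own birth skeleton, a VOLUME TRANSFER one dimension up (pattern of the
Dessins strategist's `volume_transfer` for `DimensionStep`): a continuous `(d+1)`-cube representation
of value `0` is `≡ [K_A] − [K_B]` with `K_A, K_B ⊂ ℝ^{d+2}` COMPACT unit-integrand solids of EQUAL
volume (Viu-Sos' region under the graph + closures, LANDED: `KZ.exists_sub_of_isBounded`,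
`KZ.exists_closure_of_integrand_one`, soundness), so the step is reduced, by a real 35-line proof, to

* `stub_curvedToFlat` (THE OPEN CONTENT, conditional and dimension-local): under the continuous cube
  layers `≤ d`, two compact `ℚ`-semialgebraic unit solids of `ℝ^{d+2}` with the same volume differ,
  modulo the moves, by a difference of two RATIONAL BOXES;
* `stub_ratBoxes` (provable now, M): two rational boxes with integrand `1` and the same volume are
  KZ-equivalent (Newton–Leibniz along each coordinate descends a rational box to `[pt, vol]`, and
  equal rationals give the same point representation) — Hilbert's third problem for rational boxes
  inside the calculus, the flat calibration.

Sorries: exactly the two stubs. `CubeKernelStep_of` concludes the piece's ROUTE DECL by name.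
-/

noncomputable section

set_option linter.dupNamespace false

namespace Summit.KontsevichZagierPeriods.KontsevichZagierPeriods.Cruxes.CubeKernelStep.SolidStep

open MeasureTheory Set
open Literature.NumberTheory.Transcendental
open Literature.NumberTheory.Transcendental.KZ
open Summit.KontsevichZagierPeriods.KontsevichZagierPeriods.Theses.UnfoldedStokes (CubeKernelStep)

/-- The closed unit cube `[0,1]^M`. -/
abbrev cube (M : ℕ) : Set (Fin M → ℝ) := Set.pi Set.univ (fun _ : Fin M => Set.Icc (0:ℝ) 1)

theorem isCompact_cube (M : ℕ) : IsCompact (cube M) := isCompact_univ_pi fun _ => isCompact_Icc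

/-- Layer `≤ d` of the continuous closed-cube kernel (verbatim the hypothesis of the route decl
`CubeKernelStep`, abbreviated). -/
def CubeKernelLE (d : ℕ) : Prop :=
  ∀ (M : ℕ), M ≤ d → ∀ (t : IntegralRep M), t.domain = Set.pi Set.univ (fun _ : Fin M => Set.Icc (0:ℝ) 1) →
    ContinuousOn t.integrand t.domain → t.value = 0 → of t ∈ relations

/-- A RATIONAL BOX: a product of closed intervals with rational ends. -/
def IsRatBox {n : ℕ} (s : Set (Fin n → ℝ)) : Prop :=
  ∃ a b : Fin n → ℚ, (∀ i, a i ≤ b i) ∧ s = Set.pi Set.univ (fun i => Set.Icc ((a i : ℝ)) (b i))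

/-! ## The stubs -/

/-- STUB F (`open problem`, conditional, dimension-local — the content of the piece in volume form):
**curved to flat under the lower layers.** For `d ≥ 1`, granted the continuous closed-cube kernel in
dimensions `≤ d`, two COMPACT `ℚ`-semialgebraic solids `K_A, K_B ⊂ ℝ^{d+2}` with integrand `1` and
the same volume differ, modulo `KZ.relations`, by `[P] − [Q]` for two rational boxes `P, Q` (possibly
degenerate). Why plausibly true: it is implied by the summit (`[K_A] − [K_B]` is then itself a
relation: `P = Q = ∅`-thin boxes); why not the piece reworded: unit integrands one dimension UP, and
the flat residue is split off to `stub_ratBoxes`; the cylindrical decomposition of `K_A, K_B` has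
cells with continuous semialgebraic height functions over `(d+1)`-dimensional cells, whose fibre
integrals are exactly the lower-layer periods the hypothesis speaks about. First instance `d = 1`:
compact solids in `ℝ³` under the interval layer (= the 1-period layer `PlanarAreas` ∧ Huber–Wüstholz)
— contains `ζ(2)`, dilogarithm, Legendre and `Γ`-product volume identities. -/
theorem stub_curvedToFlat :
    ∀ d : ℕ, 1 ≤ d → CubeKernelLE d →
      ∀ (KA KB : IntegralRep (d + 2)), IsCompact KA.domain → IsCompact KB.domain →
        (KA.integrand = fun _ => 1) → (KB.integrand = fun _ => 1) → KA.value = KB.value →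
        ∃ P Q : IntegralRep (d + 2), IsRatBox P.domain ∧ IsRatBox Q.domain ∧
          (P.integrand = fun _ => 1) ∧ (Q.integrand = fun _ => 1) ∧
          of KA - of KB - (of P - of Q) ∈ relations := by
  sorry

/-- STUB B (`M`, provable now): **rational boxes of equal volume are KZ-equivalent** (any dimension
`n`). Newton–Leibniz along the last coordinate with primitive `t` turns `[∏ [aᵢ,bᵢ], 1]` into
`[∏_{i<n} [aᵢ,bᵢ], b_n − a_n]`, a rational constant integrand; iterating (rational polynomial
primitives) ends at the point representation `[pt, vol]` with `vol ∈ ℚ`; two boxes of equal volume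
reach the SAME point representation. (The tree's box machinery — `KZ.exists_translate`,
`exists_isCompact_of_sub_of_sub_mem_relations_of_box`, unit slabs `IntegralRep.slab` — covers most steps.) -/
theorem stub_ratBoxes :
    ∀ (n : ℕ) (P Q : IntegralRep n), IsRatBox P.domain → IsRatBox Q.domain →
      (P.integrand = fun _ => 1) → (Q.integrand = fun _ => 1) → P.value = Q.value →
      of P - of Q ∈ relations := by
  sorry

/-! ## The composition (real proof over the landed reductions) -/

/-- **`CubeKernelStep` from the two stubs.** Given the layers `≤ d` and a continuous `(d+1)`-cube
representation `t` of value `0`: `[t] ≡ [A] − [A']` bounded unit solids of `ℝ^{d+2}`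
(`exists_sub_of_isBounded`) `≡ [K_A] − [K_B]` compact (`exists_closure_of_integrand_one`), of equal
volume by soundness; STUB F trades `[K_A] − [K_B]` for rational boxes `[P] − [Q]`, of equal volume by
soundness again; STUB B kills `[P] − [Q]`. -/
theorem CubeKernelStep_of
    (hF : ∀ d : ℕ, 1 ≤ d → CubeKernelLE d →
      ∀ (KA KB : IntegralRep (d + 2)), IsCompact KA.domain → IsCompact KB.domain →
        (KA.integrand = fun _ => 1) → (KB.integrand = fun _ => 1) → KA.value = KB.value →
        ∃ P Q : IntegralRep (d + 2), IsRatBox P.domain ∧ IsRatBox Q.domain ∧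
          (P.integrand = fun _ => 1) ∧ (Q.integrand = fun _ => 1) ∧
          of KA - of KB - (of P - of Q) ∈ relations)
    (hB : ∀ (n : ℕ) (P Q : IntegralRep n), IsRatBox P.domain → IsRatBox Q.domain →
      (P.integrand = fun _ => 1) → (Q.integrand = fun _ => 1) → P.value = Q.value →
      of P - of Q ∈ relations) :
    CubeKernelStep := by
  intro d hd hLE t htd htc hval
  -- boundedness of the continuous integrand on the compact cube
  have hK : IsCompact t.domain := by rw [htd]; exact isCompact_cube (d + 1)
  obtain ⟨B, hBB⟩ := (hK.image_of_continuousOn htc).isBounded.subset_closedBall 0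
  have hB' : ∀ z ∈ t.domain, |t.integrand z| ≤ B := fun z hz => by
    simpa [Real.norm_eq_abs] using hBB (Set.mem_image_of_mem _ hz)
  -- [t] ≡ [A] − [A'] (bounded unit solids), then compact closures
  obtain ⟨A, A', hAb, hA'b, hAi, hA'i, hrel⟩ := exists_sub_of_isBounded t hK.isBounded hB'
  obtain ⟨KA, -, hKAi, hKAc, -, hAK⟩ := exists_closure_of_integrand_one A hAi hAb
  obtain ⟨KB, -, hKBi, hKBc, -, hBK⟩ := exists_closure_of_integrand_one A' hA'i hA'b
  -- [t] − ([KA] − [KB]) is a relation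
  have hred : of t - (of KA - of KB) ∈ relations := by
    have e : of t - (of KA - of KB) = (of t - (of A - of A')) + (of A - of KA) - (of A' - of KB) := by
      abel
    rw [e]
    exact relations.sub_mem (relations.add_mem hrel hAK) hBK
  -- equal volumes by soundness
  have hvol : KA.value = KB.value := by
    have h0 := relations_le_ker_eval_holds hred
    rw [AddMonoidHom.mem_ker, map_sub, map_sub, eval_of, eval_of, eval_of, hval, zero_sub,
      neg_eq_zero, sub_eq_zero] at h0
    exact h0
  -- curved to flat, then flat to nothing
  obtain ⟨P, Q, hP, hQ, hPi, hQi, hflat⟩ := hF d hd hLE KA KB hKAc hKBc hKAi hKBi hvol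
  have hPQ : P.value = Q.value := by
    have h0 := relations_le_ker_eval_holds hflat
    rw [AddMonoidHom.mem_ker, map_sub, map_sub, map_sub, eval_of, eval_of, eval_of, eval_of, hvol,
      sub_self, zero_sub, neg_eq_zero, sub_eq_zero] at h0
    exact h0
  have hbox : of P - of Q ∈ relations := hB (d + 2) P Q hP hQ hPi hQi hPQ
  have e : of t = (of t - (of KA - of KB)) + (of KA - of KB - (of P - of Q)) + (of P - of Q) := by abel
  rw [e]
  exact relations.add_mem (relations.add_mem hred hflat) hbox

/-- The registered composition: the piece's ROUTE DECL by name from the two stubs. -/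
theorem CubeKernelStep_of_stubs : CubeKernelStep := CubeKernelStep_of stub_curvedToFlat stub_ratBoxes

end Summit.KontsevichZagierPeriods.KontsevichZagierPeriods.Cruxes.CubeKernelStep.SolidStep

end
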